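import Mathlib.LinearAlgebra.BilinearForm.Orthogonal
import Mathlib.LinearAlgebra.FiniteDimensional.Lemmas
import Mathlib.LinearAlgebra.Dimension.Finrank

/-!
# Algebraic skeleton of LEMMA H3 (WEIL-2 gen 16, door (h)): pairwise-orthogonal families are isotropic, hence span at most half the dimension

research route, not a corollary; conditional on HC_CM plus one named minimal statement.

Cell `pub-hodge-ring2-ab-*` (ALL ABELIAN VARIETIES), seat WEIL-2 gen 16, THEOREM H / LEMMA H3 of
`run/shared/lean/pub/pub-hodge-ring2/pub-hodge-ring2-ab-weil-2/SEMIREG-CM-G16.md` (door (h): semiregular anchors inside the NON-SPLIT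
`(ℚ(√-3), (3,3))` Weil component, cell `NonsplitSixfolds`).  THEOREM H says that no configuration of translated abelian threefolds of a
Weil-type abelian sixfold whose class is `λ θ³ + (Weil class)` can avoid a TRANSVERSAL pair, because (i) two translated abelian threefolds
with conormal Plücker vectors `p, p'` have disjoint generic translates iff `p ∧ p' = 0` for the non-degenerate ALTERNATING wedge pairing on
`Λ³ K⁶`, (ii) the coefficient matrix of `Σ n_B [B]` has rank at most `dim span{p_B}`, and (iii) the coefficient matrix of `λ θ³ + w` has
rank `≥ 18 > 10 = ½ · 20`.  What the KERNEL checks here is the linear algebra behind "(i) ⟹ rank ≤ 10": a family of vectors pairwise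
orthogonal for a bilinear form spans a totally isotropic subspace (`span_le_orthogonal_span_of_pairwise`), a totally isotropic subspace
of a non-degenerate form has at most half the dimension (`two_mul_finrank_le_of_le_orthogonal`, from Mathlib's
`LinearMap.BilinForm.finrank_orthogonal`), hence any subspace carried by such a span — e.g. the range of the coefficient matrix — has
`2 · finrank ≤ finrank V` (`two_mul_finrank_le_of_le_span_pairwise`), and the numerical contradiction `20 / 18`
(`no_pairwise_orthogonal_carrier_20_18`).  NOT kernel-checked (Python ×2 + proofs in the doc): the Plücker criterion, `[B] = p ∧ p̄`,
the rank `≥ 18` of the target matrix, the rigidity half of THEOREM H.  No case of the Hodge conjecture is proved; `HC_CM` is absent;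
nothing here is a rung or a node; helper of the AbelianAll crux.  No `def`; axioms standard.
-/

namespace Summit.HodgeConjecture.Ring2AbelianAll.NonsplitAnchorIsotropy

open Module

variable {K : Type*} [Field K] {V : Type*} [AddCommGroup V] [Module K V]

/-- **LEMMA H3 (c), step 1.** A family of vectors pairwise orthogonal for a bilinear form `B` (including each vector with itself —
automatic for an alternating form) spans a subspace contained in its own `B`-orthogonal: the span is totally isotropic.
research route, not a corollary; conditional on HC_CM plus one named minimal statement. -/
theorem span_le_orthogonal_span_of_pairwise {ι : Type*} (B : LinearMap.BilinForm K V) (p : ι → V)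
    (h : ∀ i j, B (p i) (p j) = 0) :
    Submodule.span K (Set.range p) ≤ B.orthogonal (Submodule.span K (Set.range p)) := by
  rw [Submodule.span_le]
  rintro _ ⟨j, rfl⟩
  rw [SetLike.mem_coe, LinearMap.BilinForm.mem_orthogonal_iff]
  intro n hn
  induction hn using Submodule.span_induction with
  | mem x hx =>
      obtain ⟨i, rfl⟩ := hx
      exact h i j
  | zero => simp
  | add x y _ _ hx hy => simp [hx, hy]
  | smul a x _ hx => simp [hx]

variable [FiniteDimensional K V]

/-- **LEMMA H3 (c), step 2.** A totally isotropic subspace `W ≤ W^⊥` of a NON-DEGENERATE bilinear form has `2 · dim W ≤ dim V`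
(Mathlib: `dim W^⊥ = dim V − dim W`).  For `Λ³ K⁶` with the wedge pairing (`dim V = 20`): isotropic subspaces have dimension `≤ 10`.
research route, not a corollary; conditional on HC_CM plus one named minimal statement. -/
theorem two_mul_finrank_le_of_le_orthogonal {B : LinearMap.BilinForm K V} (hB : B.Nondegenerate)
    (W : Submodule K V) (hW : W ≤ B.orthogonal W) : 2 * finrank K W ≤ finrank K V := by
  have h1 : finrank K W ≤ finrank K (B.orthogonal W) := Submodule.finrank_mono hW
  have h2 : finrank K (B.orthogonal W) = finrank K V - finrank K W := LinearMap.BilinForm.finrank_orthogonal hB W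
  have h3 : finrank K W ≤ finrank K V := Submodule.finrank_le W
  omega

/-- **LEMMA H3 (c)+(d) combined.** If a subspace `R` (in the application: the column space of the coefficient matrix of the class
`Σ n_B [B + t_B]`, which is spanned by the Plücker vectors `p_B`) lies in the span of a family pairwise orthogonal for a non-degenerate
form, then `2 · dim R ≤ dim V`.
research route, not a corollary; conditional on HC_CM plus one named minimal statement. -/
theorem two_mul_finrank_le_of_le_span_pairwise {ι : Type*} {B : LinearMap.BilinForm K V} (hB : B.Nondegenerate)
    (p : ι → V) (h : ∀ i j, B (p i) (p j) = 0) (R : Submodule K V) (hR : R ≤ Submodule.span K (Set.range p)) :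
    2 * finrank K R ≤ finrank K V := by
  have hiso := two_mul_finrank_le_of_le_orthogonal hB _ (span_le_orthogonal_span_of_pairwise B p h)
  have hmono : finrank K R ≤ finrank K (Submodule.span K (Set.range p)) := Submodule.finrank_mono hR
  omega

/-- **The numerical no-go used by THEOREM H (n = 3).** In a 20-dimensional space with a non-degenerate form (`Λ³ K⁶`, wedge pairing)
no family of pairwise-orthogonal vectors (Plücker vectors of pairwise NON-transversal translated abelian threefolds) can carry a subspace
of dimension `≥ 18` (the column space of the coefficient matrix of `λ θ³ + w`, `λ ≠ 0`): some pair is transversal.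
research route, not a corollary; conditional on HC_CM plus one named minimal statement. -/
theorem no_pairwise_orthogonal_carrier_20_18 {ι : Type*} {B : LinearMap.BilinForm K V} (hB : B.Nondegenerate)
    (hV : finrank K V = 20) (p : ι → V) (R : Submodule K V) (hR : R ≤ Submodule.span K (Set.range p))
    (hrank : 18 ≤ finrank K R) : ∃ i j, B (p i) (p j) ≠ 0 := by
  by_contra hcon
  push Not at hcon
  have := two_mul_finrank_le_of_le_span_pairwise hB p hcon R hR
  omega

/-- **The same no-go for every Weil `(n,n)` cell, `n ≥ 2`** (abstract form): if `dim V = N` (`N = C(2n,n)`) and the target class needs a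
carried subspace of dimension `r` with `2 r > N` (`r ≥ N − 2 > N/2` as soon as `N ≥ 5`), a pairwise-orthogonal family cannot carry it.
research route, not a corollary; conditional on HC_CM plus one named minimal statement. -/
theorem no_pairwise_orthogonal_carrier {ι : Type*} {B : LinearMap.BilinForm K V} (hB : B.Nondegenerate)
    (p : ι → V) (R : Submodule K V) (hR : R ≤ Submodule.span K (Set.range p))
    (hrank : finrank K V < 2 * finrank K R) : ∃ i j, B (p i) (p j) ≠ 0 := by
  by_contra hcon
  push Not at hcon
  have := two_mul_finrank_le_of_le_span_pairwise hB p hcon R hR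
  omega

end Summit.HodgeConjecture.Ring2AbelianAll.NonsplitAnchorIsotropy
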